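import Summits.CriticalPhenomena.PercolationContinuityZ3.Theses.PercShatteringRace
import Literature.Probability.LatticeModels.ThermodynamicLimit
import HarnessLib

/-!
# Crux `PercShatteringRace.FreeSusceptibilityPowerSaving` = S(1/2) (stmt-CriticalPhenomena-5786), line `bk-hyperscaling-tail-transfer` — the HÖLDER FAMILY bridge `H(q) ⟹ S(1/2)` (census S⁺3)

Helper file of the line lead (prover-line-stmt-CriticalPhenomena-5786-c3-0, cycle 3), `--supports stmt-CriticalPhenomena-5786`.
It lands the registered stub `stub_holderBridge` of the checked skeleton of the line (census S⁺3, the "Hölder family"):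
for every real `q ≥ 1`, the `q`-th power-sum hypothesis

  `H(q)`: `∃ C, ∀ R ≥ 1, Σ_{y ∈ Λ_R} P_{p_c}(0 ↔ y in Λ_R)^q ≤ C R^{3 - q/2}` (`Λ_R = box 3 R`, bond percolation on `ℤ³` at
  `p_c = criticalProbI 3`, connections inside the box),

implies the crux `FreeSusceptibilityPowerSaving` = S(1/2) (`∃ C, ∀ R ≥ 1, Σ_{y ∈ Λ_R} P_{p_c}(0 ↔ y in Λ_R) ≤ C R^{5/2}`) BY NAME.
The proof is the power-mean / Hölder inequality with the constant weight (Mathlib's `Real.inner_le_weight_mul_Lp_of_nonneg`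
with `w ≡ 1`): with `a_y = P_{p_c}(0 ↔ y in Λ_R) ≥ 0`,
`Σ_y a_y ≤ |Λ_R|^{1 - 1/q} (Σ_y a_y^q)^{1/q} ≤ (27 R³)^{1 - 1/q} (C' R^{3 - q/2})^{1/q} = 27^{1-1/q} C'^{1/q} R^{5/2}`,
where `|Λ_R| = (2R+1)³ ≤ 27 R³` (`card_box`, `R ≥ 1`) and `C' = max C 1 ≥ 0` (the hypothesis with `C` gives it with `C'`).
Status (census): the antecedent `H(q)` is OPEN for every `q` (jump-compatible for `q < 6`, summit-strength for `q ≥ 6`; no engine in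
`d = 3`); this file is interface glue, not progress on the wall.  No definitions, Mathlib-only lemmas plus `card_box`.
-/

noncomputable section

namespace Summit.CriticalPhenomena.PercolationContinuityZ3.Theorems

open MeasureTheory
open Literature.Probability.Percolation Literature.Probability.LatticeModels

namespace StubHolderBridge

/-- **Power mean / Hölder with constant weight.** For `a ≥ 0` on a finset `s` and a real `q ≥ 1`:
`Σ_{i∈s} a_i ≤ |s|^{1 - 1/q} (Σ_{i∈s} a_i^q)^{1/q}` (Mathlib's weighted Hölder inequality
`Real.inner_le_weight_mul_Lp_of_nonneg` with the weight `w ≡ 1`). [folklore] -/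
theorem sum_le_card_rpow_mul_rpow {ι : Type*} (s : Finset ι) {q : ℝ} (hq : 1 ≤ q)
    (a : ι → ℝ) (ha : ∀ i, 0 ≤ a i) :
    ∑ i ∈ s, a i ≤ (s.card : ℝ) ^ (1 - q⁻¹) * (∑ i ∈ s, a i ^ q) ^ q⁻¹ := by
  have h := Real.inner_le_weight_mul_Lp_of_nonneg s hq (fun _ => (1 : ℝ)) a (fun _ => zero_le_one) ha
  simpa using h

/-- `|Λ_R| = (2R+1)³ ≤ 27 R³` for `R ≥ 1` (`card_box`), in `rpow` form. [folklore] -/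
theorem card_box_three_le {R : ℕ} (hR : 1 ≤ R) :
    ((box 3 R).card : ℝ) ≤ 27 * (R : ℝ) ^ (3 : ℝ) := by
  rw [card_box, Real.rpow_ofNat]
  have hR1 : (1 : ℝ) ≤ R := by exact_mod_cast hR
  calc (((2 * R + 1) ^ 3 : ℕ) : ℝ) = (2 * (R : ℝ) + 1) ^ 3 := by push_cast; ring
    _ ≤ (3 * (R : ℝ)) ^ 3 := pow_le_pow_left₀ (by positivity) (by linarith) 3
    _ = 27 * (R : ℝ) ^ 3 := by ring

/-- **Exponent bookkeeping.** For `q ≥ 1`, `R ≥ 1`, `0 ≤ N ≤ 27 R³`, `0 ≤ T ≤ K R^{3 - q/2}` (`K ≥ 0`):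
`N^{1 - 1/q} T^{1/q} ≤ 27^{1 - 1/q} K^{1/q} R^{5/2}`, since `3(1 - 1/q) + (3 - q/2)/q = 5/2`. [folklore] -/
theorem bookkeeping {q N T K : ℝ} {R : ℕ} (hq : 1 ≤ q) (hR : 1 ≤ R) (hN0 : 0 ≤ N) (hT0 : 0 ≤ T)
    (hK : 0 ≤ K) (hN : N ≤ 27 * (R : ℝ) ^ (3 : ℝ)) (hT : T ≤ K * (R : ℝ) ^ (3 - q / 2)) :
    N ^ (1 - q⁻¹) * T ^ q⁻¹ ≤ (27 : ℝ) ^ (1 - q⁻¹) * K ^ q⁻¹ * (R : ℝ) ^ ((5 : ℝ) / 2) := by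
  have hq0 : 0 < q := by linarith
  have ht0 : 0 ≤ q⁻¹ := inv_nonneg.2 hq0.le
  have ht1 : q⁻¹ ≤ 1 := inv_le_one_of_one_le₀ hq
  have h1t : 0 ≤ 1 - q⁻¹ := sub_nonneg.2 ht1
  have hR0 : (0 : ℝ) < R := by exact_mod_cast hR
  have hRnn : (0 : ℝ) ≤ R := hR0.le
  have h1 : N ^ (1 - q⁻¹) ≤ (27 * (R : ℝ) ^ (3 : ℝ)) ^ (1 - q⁻¹) := Real.rpow_le_rpow hN0 hN h1t
  have h2 : T ^ q⁻¹ ≤ (K * (R : ℝ) ^ (3 - q / 2)) ^ q⁻¹ := Real.rpow_le_rpow hT0 hT ht0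
  have e1 : (27 * (R : ℝ) ^ (3 : ℝ)) ^ (1 - q⁻¹) = (27 : ℝ) ^ (1 - q⁻¹) * (R : ℝ) ^ (3 * (1 - q⁻¹)) := by
    rw [Real.mul_rpow (by norm_num) (Real.rpow_nonneg hRnn _), ← Real.rpow_mul hRnn]
  have e2 : (K * (R : ℝ) ^ (3 - q / 2)) ^ q⁻¹ = K ^ q⁻¹ * (R : ℝ) ^ ((3 - q / 2) * q⁻¹) := by
    rw [Real.mul_rpow hK (Real.rpow_nonneg hRnn _), ← Real.rpow_mul hRnn]
  have e3 : (R : ℝ) ^ (3 * (1 - q⁻¹)) * (R : ℝ) ^ ((3 - q / 2) * q⁻¹) = (R : ℝ) ^ ((5 : ℝ) / 2) := by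
    rw [← Real.rpow_add hR0]
    congr 1
    field_simp
    ring
  calc N ^ (1 - q⁻¹) * T ^ q⁻¹
      ≤ (27 * (R : ℝ) ^ (3 : ℝ)) ^ (1 - q⁻¹) * (K * (R : ℝ) ^ (3 - q / 2)) ^ q⁻¹ :=
        mul_le_mul h1 h2 (Real.rpow_nonneg hT0 _) (Real.rpow_nonneg (by positivity) _)
    _ = (27 : ℝ) ^ (1 - q⁻¹) * K ^ q⁻¹ * ((R : ℝ) ^ (3 * (1 - q⁻¹)) * (R : ℝ) ^ ((3 - q / 2) * q⁻¹)) := by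
        rw [e1, e2]; ring
    _ = (27 : ℝ) ^ (1 - q⁻¹) * K ^ q⁻¹ * (R : ℝ) ^ ((5 : ℝ) / 2) := by rw [e3]

end StubHolderBridge

/-- **stub_holderBridge (census S⁺3, the Hölder family `H(q) ⟹ S(1/2)`; registered stub of the crux item
stmt-CriticalPhenomena-5786, line `bk-hyperscaling-tail-transfer`).**  For every real `q ≥ 1`: if
`Σ_{y ∈ Λ_R} P_{p_c}(0 ↔ y in Λ_R)^q ≤ C R^{3 - q/2}` for all `R ≥ 1`, then the crux
`FreeSusceptibilityPowerSaving` (`Σ_{y ∈ Λ_R} P_{p_c}(0 ↔ y in Λ_R) ≤ C' R^{5/2}` for all `R ≥ 1`) holds, by name.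
Proof: power mean / Hölder `Σ a_y ≤ |Λ_R|^{1-1/q} (Σ a_y^q)^{1/q}`, `|Λ_R| = (2R+1)³ ≤ 27 R³`, and
`3(1 - 1/q) + (3 - q/2)/q = 5/2`; constant `27^{1-1/q} (max C 1)^{1/q}`.  At `q = 1` the hypothesis is S itself. [folklore] -/
theorem stub_holderBridge :
    ∀ q : ℝ, 1 ≤ q →
      (∃ C : ℝ, ∀ R : ℕ, 1 ≤ R →
        ∑ y ∈ box 3 R,
          (bondPercolation (zdGraph 3) (criticalProbI 3)).real (openConnIn ↑(box 3 R) 0 y) ^ q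
          ≤ C * (R : ℝ) ^ (3 - q / 2)) →
      Summit.CriticalPhenomena.PercolationContinuityZ3.Theses.PercShatteringRace.FreeSusceptibilityPowerSaving := by
  rintro q hq ⟨C, hC⟩
  show ∃ C : ℝ, ∀ R : ℕ, 1 ≤ R →
    ∑ y ∈ box 3 R, (bondPercolation (zdGraph 3) (criticalProbI 3)).real (openConnIn ↑(box 3 R) 0 y)
      ≤ C * (R : ℝ) ^ ((5 : ℝ) / 2)
  refine ⟨(27 : ℝ) ^ (1 - q⁻¹) * (max C 1) ^ q⁻¹, fun R hR => ?_⟩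
  have ha : ∀ y : Site 3,
      0 ≤ (bondPercolation (zdGraph 3) (criticalProbI 3)).real (openConnIn ↑(box 3 R) 0 y) :=
    fun _ => measureReal_nonneg
  have hT : ∑ y ∈ box 3 R,
      (bondPercolation (zdGraph 3) (criticalProbI 3)).real (openConnIn ↑(box 3 R) 0 y) ^ q
        ≤ max C 1 * (R : ℝ) ^ (3 - q / 2) :=
    (hC R hR).trans (mul_le_mul_of_nonneg_right (le_max_left _ _) (Real.rpow_nonneg (Nat.cast_nonneg _) _))
  exact (StubHolderBridge.sum_le_card_rpow_mul_rpow (box 3 R) hq _ ha).trans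
    (StubHolderBridge.bookkeeping hq hR (Nat.cast_nonneg _)
      (Finset.sum_nonneg fun y _ => Real.rpow_nonneg (ha y) _) (zero_le_one.trans (le_max_right _ _))
      (StubHolderBridge.card_box_three_le hR) hT)

end Summit.CriticalPhenomena.PercolationContinuityZ3.Theorems

end
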